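import Summits.QuantumFields.YangMills.Theorems.UnitScaleTiltProp7CritEL
import Summits.QuantumFields.YangMills.Theorems.UnitScaleTiltProp7Growth142T3ChartKnit
import Summits.QuantumFields.YangMills.Theorems.UnitScaleTiltProp8EulerLagrangeDeriv
import Mathlib.Analysis.SpecialFunctions.Exponential
import HarnessLib

/-!
# Route `UnitScaleTilt`, crux K1 child «MinimiserStabilityRegPr» (stmt-QuantumFields-19200), skeleton v10 — THE `EL_W` JUNCTION OF THE (α)-CURRENCY GROWTH KNIT
# ([Balaban1985Variational] (141) p. 299 «⟨δA′, J⟩ = 0 for all δA′ : QδA′ = 0, RD*δA′ = 0»): the first variation of the Wilson action at an R2-critical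
# configuration VANISHES ALONG EVERY CURVE OF PRINT'S SURFACE Σ_k (gauge-saturated fibre), and is Lipschitz-small off it

Cell `ym3-torus`, width seat `ym-ust-19200-w4` (gen 4; ★★OWNER RULING g26-№26 (b) 2026-08-28: «the one junction to type — `EL_W` from `eq137cov`-linearity +
R2-criticality — is ★w4-19200 g4's»).  THEOREMS ONLY (0 `def`, 0 `sorry`).  YM₃ on T³ is a ladder rung (R3), not the Clay problem; nothing here claims the stub,
the crux, d = 4 or the mass gap.

WHY (RULING №25 ∕ №26, numbers not adjectives).  The cell's chart-free growth rows («critical ⇒ minimal against a general fibre competitor») came in two currencies: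
the PINNED representative (`descTransf g = 1`: (ii′) `Σ‖Y‖² ≤ C_P ℓ² Σ_p‖R_p − 1‖²` — numerically NOT k-uniform, ★p1 g11 jobs j298832–j305434, `ℓ²λ_core ≈ 1.3ε₀²∕ℓ`)
and the UN-PINNED Landau representative (leaves the fibre: `U^u ∈ 𝔅_k(V^{u↓})`, first-variation drift `⟨λ, V^{u↓} − V⟩` first order in `u↓ − 1`, ★w5-20520 g0
LOCATE 2026-08-28 03:06Z (3)).  PRINT'S EXIT IS NEITHER: p. 299 charts the competitor at the critical background by [Balaban1985RegularSpaces] Thm 2 with the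
AVERAGE-normalised `u` ((1.29) `R₀u_j = 1`, not the pinned group (1.14) «very hard to work with analytically», p. 80), accepts «Σ_k is not contained in 𝔅_k(𝔅_k, V)»
(p. 81), and kills the first variation IDENTICALLY on the linear slice — because the derivative of the gauge-invariant action (5) at a constrained critical point
vanishes on the tangent space of the fibre AND on every infinitesimal gauge direction, pinned or not, i.e. on the tangent space of Σ_k = (fibre)·(all gauge
transformations).  This file proves exactly that, in the carrier's letters, and packages it as the `hEL` row of the chart-currency knit
`Prop7Growth142T3ChartKnit.cmin_minimality_of_chartRows` (TAYLOR3_W already a theorem there: `Prop7Taylor3Word.abs_wilsonAction4_expChart_sub_taylor2_le`).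

WHAT IS PROVED (ns `…Theorems.Prop7Growth142T3ChartEL`; `Lin_W(ξ)` = the first-variation functional of `Prop8Criticality.lin_eq_zero_of_isMinOn_of_hasDerivAt`,
`ℓ_W(D) := Lin_W(iD)` = the `hEL` letter of the knit).
§1 Σ_k-CURVES.  `isMinOn_gaugeSat` (a minimiser over `S` minimises over the gauge saturation `{U | ∃ u, U^u ∈ S}` — (5) is gauge invariant);
   ★ `lin_eq_zero_of_isMinOn_of_gaugeSat_hasDerivAt` (`IsMinOn A S W`, `γ 0 = W`, `∀ᶠ t, ∃ u, (γ t)^u ∈ S`, bond velocities `ξ` ⟹ `Lin_W(ξ) = 0`);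
   ★★ `lin_eq_zero_of_isCritR2_of_gaugeFibre` (the R2 form: `W` R2-critical over `V`, `γ` continuous at `0` with `∀ᶠ t, ∃ u, (γ t)^u ∈ 𝔅_k(V)` ⟹ `Lin_W(ξ) = 0`;
   `(6)(e′)` is open — `Prop7CritEL.isOpen_regPr` — and gauge invariant — `regPr_gaugeAct_iff`); `isLocalMin_comp_of_isCritR2_of_gaugeFibre` (local minimum
   along Σ_k-curves, whence `deriv = 0` by `IsLocalMin.deriv_eq_zero`).
§2 THE EXPONENTIAL RAY `t ↦ e^{itD}W = emb15 W (expHermField (t • D))` (`D` Hermitian-traceless): `coe_expHermRay_mul_star` (`(e^{itD}W)(b)·W(b)^* = exp(t·iD(b))`),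
   `hasDerivAt_expHermRay` (bond velocity `iD(b)`), `continuousAt_expHermRay`, `expHermRay_zero`.
§3 THE `hEL` ROW.  ★★ `lin_chart_eq_zero_of_isCritR2_of_raySigma` (R2-critical `W`, `∀ᶠ t, ∃ u, (e^{itD}W)^u ∈ 𝔅_k(V)` ⟹ `ℓ_W(D) = 0` — λ = 0);
   ★ `abs_lin_sub_lin_le_of_plaqSmall` (`|Lin_W(ξ) − Lin_W(ξ′)| ≤ 4d·a·Σ_b‖ξ b − ξ′ b‖` at a background with plaquettes within `a` of `1` — `Lin_W` is Lipschitz with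
   the SMALL constant `12a`; T3W §7 `norm_lin_sub_lin_le` + `Prop7ExactExpansion.abs_half_re_trace_sub_le` + incidence `Prop7FlatLocalMin.sum_plaq_bonds_le`);
   ★★ `abs_lin_chart_le_of_sigmaVelocity` (R2-critical `W ∈ 𝔘_k(e)`: for ANY Σ_k-curve through `W` with bond velocities `ξ`, `|ℓ_W(D)| ≤ 12·e·L^{−2(K−n)}·Σ_b‖iD(b) − ξ(b)‖`
   — the first variation of a GENERAL chart competitor is controlled by its distance to the tangent space of Σ_k ALONE: the drift-free form of (141) for curved
   coordinates; with print's straightening (47)–(48) `D − ξ = −H·(quadratic defect)` this is `O(e·ℓ⁻²)·Σ‖D‖²`, the `λ` of the knit's `hEL`).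
§4 (separate file `…MinimiserStabilityRegPrPV3ESigma`): the E′ text of record (OWNER RULING g24-№3) from CHART_W^Σ ∧ NORMAL_W ∧ HESS_W with `EL_W` (this file) and
   TAYLOR3_W (T3W) discharged.

HONEST SCOPE.  Carrier-side calculus (Fermat on the gauge saturation, the exponential ray, a Lipschitz bound); no chart is constructed and nothing of print is asserted;
`--supports stmt-QuantumFields-19200`, count-neutral; no stub or crux is closed by this file.

References: T. Bałaban, CMP 102 (1985) 277–309 [Balaban1985Variational] ((4)–(6), (19)–(21), (47)–(48), (123)–(127), (141)–(142)); CMP 99 (1985) 75–102 [Balaban1985RegularSpaces] ((1.14), (1.28)–(1.31), Thm 2).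
-/

set_option autoImplicit false
noncomputable section

open scoped BigOperators Matrix.Norms.L2Operator Matrix Topology
open Filter NormedSpace

namespace Summit.QuantumFields.YangMills.Theorems.Prop7Growth142T3ChartEL

open Literature.MathematicalPhysics.QuantumFieldTheory.Balaban1983to89
open Literature.MathematicalPhysics.QuantumFieldTheory.Balaban1983to89.T3ContinuumYM3Torus
open Literature.MathematicalPhysics.QuantumFieldTheory.Balaban1983to89.T3UnitLawDensityEML (ℰp)
open Literature.MathematicalPhysics.QuantumFieldTheory.Balaban1983to89.T3ConstrainedMinimiser
open Literature.MathematicalPhysics.QuantumFieldTheory.Balaban1983to89.T3Thm1Carrier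
open Literature.MathematicalPhysics.QuantumFieldTheory.Balaban1983to89.T3PrintedRegularMinimiser
open Literature.MathematicalPhysics.QuantumFieldTheory.Balaban1983to89.T3RegularMinimiser
open Literature.MathematicalPhysics.QuantumFieldTheory.Balaban1983to89.T3PrintedRegularOrbits (regPr_gaugeAct_iff)
open Literature.MathematicalPhysics.QuantumFieldTheory.Balaban1983to89.T3Thm1CarrierNative (IsCritR2)
open Literature.MathematicalPhysics.QuantumFieldTheory.Balaban1983to89.T3SectALandauChart (emb15 CloseAvg pos_of_regPr)
open Summit.QuantumFields.YangMills.Theorems.Prop7TPrint (expHerm coe_expHerm expHermField expHermField_apply)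
open Summit.QuantumFields.YangMills.Theorems.Prop7CritEL (isOpen_regPr continuousAt_of_differentiableAt_bonds)
open Summit.QuantumFields.YangMills.Theorems.Prop8Criticality (lin_eq_zero_of_isMinOn_of_hasDerivAt)
open Summit.QuantumFields.YangMills.Theorems.PerturbedPlaquette (norm_conj_SU)
open Summit.QuantumFields.YangMills.Theorems.Prop7ExactExpansion (abs_half_re_trace_sub_le)
open Summit.QuantumFields.YangMills.Theorems.Prop7FlatLocalMin (sum_plaq_bonds_le)
open Summit.QuantumFields.YangMills.Theorems.Prop7Taylor3Word (norm_lin_sub_lin_le neg_le_wilsonAction4_expChart_sub_taylor2)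

/-! ## §1 The first variation vanishes along curves of the gauge-saturated fibre (print's Σ_k) -/

section Sigma

variable {P : Params} {j : ℕ}

/-- **A MINIMISER OVER `S` MINIMISES OVER THE GAUGE SATURATION `{U | ∃ u, U^u ∈ S}`** — the action (5) is gauge invariant; this is why print may chart
competitors OUTSIDE the fibre («Σ_k is not contained in 𝔅_k(𝔅_k, V)», [Balaban1985RegularSpaces] p. 81). [cite: Balaban1985Variational, (4)-(5) p.278; Balaban1985RegularSpaces, (1.28)-(1.30) p.81] -/
theorem isMinOn_gaugeSat {S : Set (GaugeField P j (Matrix.specialUnitaryGroup (Fin 2) ℂ))} {W : GaugeField P j (Matrix.specialUnitaryGroup (Fin 2) ℂ)}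
    (hmin : IsMinOn (fun U : GaugeField P j (Matrix.specialUnitaryGroup (Fin 2) ℂ) => wilsonAction4 U) S W) :
    IsMinOn (fun U : GaugeField P j (Matrix.specialUnitaryGroup (Fin 2) ℂ) => wilsonAction4 U)
      {U | ∃ u : GaugeTransf P j (Matrix.specialUnitaryGroup (Fin 2) ℂ), GaugeField.gaugeAct u U ∈ S} W := by
  intro U hU
  obtain ⟨u, hu⟩ := hU
  show wilsonAction4 W ≤ wilsonAction4 U
  calc wilsonAction4 W ≤ wilsonAction4 (GaugeField.gaugeAct u U) := hmin hu
    _ = wilsonAction4 U := T4WilsonGaugeFlatDirection.wilsonAction_gaugeAct 1 u U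

/-- ★ **EULER–LAGRANGE ALONG Σ_k-CURVES** ([Balaban1985Variational] (141) chart-free): if `W` minimises the Wilson action over `S`, and `γ` is a curve through `W` whose
points have GAUGE COPIES in `S` near `t = 0` (any gauge transformations — pinned or not) and whose bond coordinates `t ↦ γ(t)(b)W(b)^*` have derivatives `ξ(b)` at `0`,
then the first variation vanishes: `Lin_W(ξ) = 0`. [cite: Balaban1985Variational, (141) p.299, (127) p.297; Balaban1985RegularSpaces, (1.28)-(1.30) p.81] -/
theorem lin_eq_zero_of_isMinOn_of_gaugeSat_hasDerivAt {S : Set (GaugeField P j (Matrix.specialUnitaryGroup (Fin 2) ℂ))}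
    {W : GaugeField P j (Matrix.specialUnitaryGroup (Fin 2) ℂ)}
    (hmin : IsMinOn (fun U : GaugeField P j (Matrix.specialUnitaryGroup (Fin 2) ℂ) => wilsonAction4 U) S W)
    (γ : ℝ → GaugeField P j (Matrix.specialUnitaryGroup (Fin 2) ℂ))
    (hγS : ∀ᶠ t in 𝓝 (0 : ℝ), ∃ u : GaugeTransf P j (Matrix.specialUnitaryGroup (Fin 2) ℂ), GaugeField.gaugeAct u (γ t) ∈ S) (hγ0 : γ 0 = W)
    (ξ : PBond P j → Matrix (Fin 2) (Fin 2) ℂ)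
    (hγξ : ∀ b : PBond P j,
      HasDerivAt (fun t : ℝ => (γ t b : Matrix (Fin 2) (Fin 2) ℂ) * star (W b : Matrix (Fin 2) (Fin 2) ℂ)) (ξ b) 0) :
    ∑ p : Plaq P j, (1 / 2) * ((((((GaugeField.plaqHol W p : Matrix.specialUnitaryGroup (Fin 2) ℂ) : Matrix (Fin 2) (Fin 2) ℂ)) - 1)ᴴ
          * ((ξ ⟨p.src, p.μ⟩
              + (W ⟨p.src, p.μ⟩ : Matrix (Fin 2) (Fin 2) ℂ) * ξ ⟨p.src.shift p.μ, p.ν⟩ * star (W ⟨p.src, p.μ⟩ : Matrix (Fin 2) (Fin 2) ℂ)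
              - ((W ⟨p.src, p.μ⟩ * W ⟨p.src.shift p.μ, p.ν⟩ * (W ⟨p.src.shift p.ν, p.μ⟩)⁻¹ : Matrix.specialUnitaryGroup (Fin 2) ℂ) : Matrix (Fin 2) (Fin 2) ℂ)
                  * ξ ⟨p.src.shift p.ν, p.μ⟩
                  * star ((W ⟨p.src, p.μ⟩ * W ⟨p.src.shift p.μ, p.ν⟩ * (W ⟨p.src.shift p.ν, p.μ⟩)⁻¹ : Matrix.specialUnitaryGroup (Fin 2) ℂ) : Matrix (Fin 2) (Fin 2) ℂ)
              - ((GaugeField.plaqHol W p : Matrix.specialUnitaryGroup (Fin 2) ℂ) : Matrix (Fin 2) (Fin 2) ℂ) * ξ ⟨p.src, p.ν⟩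
                  * star ((GaugeField.plaqHol W p : Matrix.specialUnitaryGroup (Fin 2) ℂ) : Matrix (Fin 2) (Fin 2) ℂ))
            * ((GaugeField.plaqHol W p : Matrix.specialUnitaryGroup (Fin 2) ℂ) : Matrix (Fin 2) (Fin 2) ℂ))).trace).re = 0 :=
  lin_eq_zero_of_isMinOn_of_hasDerivAt (isMinOn_gaugeSat hmin) γ hγS hγ0 ξ hγξ

end Sigma

section R2

variable {F : T3Family} {n K : ℕ} {h : n ≤ K}

/-- Along a curve continuous at `0` through a configuration `W ∈ 𝔘_k(e)` whose points have gauge copies in the fibre `𝔅_k(V)`, the gauge copies lie in print's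
regular fibre `(6)(e) ∩ 𝔅_k(V)` near `t = 0`: `𝔘_k(e)` is OPEN (`Prop7CritEL.isOpen_regPr`) and GAUGE INVARIANT (`regPr_gaugeAct_iff`).
[cite: Balaban1985Variational, (2), (6) p.278] -/
theorem eventually_gaugeCopy_mem_regFibrePr {e : ℝ} (he : 0 ≤ e) {V : GaugeField (F.P n) 0 (Matrix.specialUnitaryGroup (Fin 2) ℂ)}
    {W : GaugeField (F.P K) 0 (Matrix.specialUnitaryGroup (Fin 2) ℂ)} (hW : RegPr F n K e W)
    (γ : ℝ → GaugeField (F.P K) 0 (Matrix.specialUnitaryGroup (Fin 2) ℂ)) (hγ0 : γ 0 = W) (hγc : ContinuousAt γ 0)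
    (hγfib : ∀ᶠ t in 𝓝 (0 : ℝ), ∃ u : GaugeTransf (F.P K) 0 (Matrix.specialUnitaryGroup (Fin 2) ℂ), GaugeField.gaugeAct u (γ t) ∈ fibre F ℰp n K h V) :
    ∀ᶠ t in 𝓝 (0 : ℝ), ∃ u : GaugeTransf (F.P K) 0 (Matrix.specialUnitaryGroup (Fin 2) ℂ), GaugeField.gaugeAct u (γ t) ∈ regFibrePr F n K h e V := by
  have hO : {U : GaugeField (F.P K) 0 (Matrix.specialUnitaryGroup (Fin 2) ℂ) | RegPr F n K e U} ∈ 𝓝 (γ 0) := by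
    rw [hγ0]; exact (isOpen_regPr F n K e).mem_nhds hW
  have hev : ∀ᶠ t in 𝓝 (0 : ℝ), RegPr F n K e (γ t) := hγc.preimage_mem_nhds hO
  filter_upwards [hev, hγfib] with t ht hfib
  obtain ⟨u, hu⟩ := hfib
  exact ⟨u, (mem_regFibrePr_iff F).mpr ⟨hu, (regPr_gaugeAct_iff F he u (γ t)).mpr ht⟩⟩

/-- **R2-CRITICAL ⇒ LOCAL MINIMUM ALONG Σ_k-CURVES**: `W` R2-critical over `V`, `γ` continuous at `0` through `W` with gauge copies in `𝔅_k(V)` near `0` ⟹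
`t ↦ A(γ t)` has a local minimum at `0`. [cite: Balaban1985Variational, (5)-(6) p.278, (141) p.299] -/
theorem isLocalMin_comp_of_isCritR2_of_gaugeFibre {V : GaugeField (F.P n) 0 (Matrix.specialUnitaryGroup (Fin 2) ℂ)}
    {W : GaugeField (F.P K) 0 (Matrix.specialUnitaryGroup (Fin 2) ℂ)} (hW : IsCritR2 F n K h V W)
    (γ : ℝ → GaugeField (F.P K) 0 (Matrix.specialUnitaryGroup (Fin 2) ℂ)) (hγ0 : γ 0 = W) (hγc : ContinuousAt γ 0)
    (hγfib : ∀ᶠ t in 𝓝 (0 : ℝ), ∃ u : GaugeTransf (F.P K) 0 (Matrix.specialUnitaryGroup (Fin 2) ℂ), GaugeField.gaugeAct u (γ t) ∈ fibre F ℰp n K h V) :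
    IsLocalMin (fun t => wilsonAction4 (γ t)) 0 := by
  obtain ⟨e, he, hWmem, hmin⟩ := hW
  have hWreg : RegPr F n K e W := ((mem_regFibrePr_iff F).mp hWmem).2
  have hev := eventually_gaugeCopy_mem_regFibrePr he.le hWreg γ hγ0 hγc hγfib
  show ∀ᶠ t in 𝓝 (0 : ℝ), wilsonAction4 (γ 0) ≤ wilsonAction4 (γ t)
  filter_upwards [hev] with t ht
  rw [hγ0]
  exact isMinOn_gaugeSat hmin ht

/-- ★★ **THE FIRST VARIATION AT AN R2-CRITICAL `W` VANISHES ON THE TANGENT SPACE OF Σ_k** ([Balaban1985Variational] (141) «⟨δA′, J⟩ = 0 for all δA′ : QδA′ = 0,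
RD*δA′ = 0», chart-free): for a curve `γ` through `W`, continuous at `0`, whose points have gauge copies (ANY `u`, pinned or not) in `𝔅_k(V)` near `0` and whose bond
coordinates `γ(t)(b)W(b)^*` have derivatives `ξ(b)`, `Lin_W(ξ) = 0`.  (The pinned horn and the un-pinned drift both disappear: neither the representative's length nor
its averages enter — only gauge invariance of (5) and openness of (6)(e′).) [cite: Balaban1985Variational, (141) p.299, (4)-(6) p.278; Balaban1985RegularSpaces, (1.28)-(1.30) p.81] -/
theorem lin_eq_zero_of_isCritR2_of_gaugeFibre {V : GaugeField (F.P n) 0 (Matrix.specialUnitaryGroup (Fin 2) ℂ)}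
    {W : GaugeField (F.P K) 0 (Matrix.specialUnitaryGroup (Fin 2) ℂ)} (hW : IsCritR2 F n K h V W)
    (γ : ℝ → GaugeField (F.P K) 0 (Matrix.specialUnitaryGroup (Fin 2) ℂ)) (hγ0 : γ 0 = W) (hγc : ContinuousAt γ 0)
    (hγfib : ∀ᶠ t in 𝓝 (0 : ℝ), ∃ u : GaugeTransf (F.P K) 0 (Matrix.specialUnitaryGroup (Fin 2) ℂ), GaugeField.gaugeAct u (γ t) ∈ fibre F ℰp n K h V)
    (ξ : PBond (F.P K) 0 → Matrix (Fin 2) (Fin 2) ℂ)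
    (hγξ : ∀ b : PBond (F.P K) 0,
      HasDerivAt (fun t : ℝ => (γ t b : Matrix (Fin 2) (Fin 2) ℂ) * star (W b : Matrix (Fin 2) (Fin 2) ℂ)) (ξ b) 0) :
    ∑ p : Plaq (F.P K) 0, (1 / 2) * ((((((GaugeField.plaqHol W p : Matrix.specialUnitaryGroup (Fin 2) ℂ) : Matrix (Fin 2) (Fin 2) ℂ)) - 1)ᴴ
          * ((ξ ⟨p.src, p.μ⟩
              + (W ⟨p.src, p.μ⟩ : Matrix (Fin 2) (Fin 2) ℂ) * ξ ⟨p.src.shift p.μ, p.ν⟩ * star (W ⟨p.src, p.μ⟩ : Matrix (Fin 2) (Fin 2) ℂ)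
              - ((W ⟨p.src, p.μ⟩ * W ⟨p.src.shift p.μ, p.ν⟩ * (W ⟨p.src.shift p.ν, p.μ⟩)⁻¹ : Matrix.specialUnitaryGroup (Fin 2) ℂ) : Matrix (Fin 2) (Fin 2) ℂ)
                  * ξ ⟨p.src.shift p.ν, p.μ⟩
                  * star ((W ⟨p.src, p.μ⟩ * W ⟨p.src.shift p.μ, p.ν⟩ * (W ⟨p.src.shift p.ν, p.μ⟩)⁻¹ : Matrix.specialUnitaryGroup (Fin 2) ℂ) : Matrix (Fin 2) (Fin 2) ℂ)
              - ((GaugeField.plaqHol W p : Matrix.specialUnitaryGroup (Fin 2) ℂ) : Matrix (Fin 2) (Fin 2) ℂ) * ξ ⟨p.src, p.ν⟩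
                  * star ((GaugeField.plaqHol W p : Matrix.specialUnitaryGroup (Fin 2) ℂ) : Matrix (Fin 2) (Fin 2) ℂ))
            * ((GaugeField.plaqHol W p : Matrix.specialUnitaryGroup (Fin 2) ℂ) : Matrix (Fin 2) (Fin 2) ℂ))).trace).re = 0 := by
  obtain ⟨e, he, hWmem, hmin⟩ := hW
  have hWreg : RegPr F n K e W := ((mem_regFibrePr_iff F).mp hWmem).2
  exact lin_eq_zero_of_isMinOn_of_gaugeSat_hasDerivAt hmin γ (eventually_gaugeCopy_mem_regFibrePr he.le hWreg γ hγ0 hγc hγfib) hγ0 ξ hγξ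

end R2

/-! ## §2 The exponential ray `t ↦ e^{itD}W` at a background `W` -/

section Ray

variable {F : T3Family} {K : ℕ}

/-- For a Hermitian traceless `Y` and a real `t`, `(t : ℂ) • Y` is Hermitian traceless. [folklore] -/
theorem herm_tr_ofReal_smul {Y : Matrix (Fin 2) (Fin 2) ℂ} (hY : Y.IsHermitian ∧ Matrix.trace Y = 0) (t : ℝ) :
    ((t : ℂ) • Y).IsHermitian ∧ Matrix.trace ((t : ℂ) • Y) = 0 := by
  refine ⟨hY.1.smul ?_, ?_⟩
  · exact Complex.conj_ofReal t
  · rw [Matrix.trace_smul, hY.2, smul_zero]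

/-- **THE RAY'S BOND COORDINATE**: `(e^{itD}W)(b)·W(b)^* = exp(i·t·D(b))` for `D` Hermitian-traceless (`W(b)` unitary).
[cite: Balaban1985Variational, (112) p.294, (19) p.281] -/
theorem coe_expHermRay_mul_star (W : GaugeField (F.P K) 0 (Matrix.specialUnitaryGroup (Fin 2) ℂ)) (D : PBond (F.P K) 0 → Matrix (Fin 2) (Fin 2) ℂ)
    (hD : ∀ b : PBond (F.P K) 0, (D b).IsHermitian ∧ Matrix.trace (D b) = 0) (t : ℝ) (b : PBond (F.P K) 0) :
    ((emb15 W (expHermField (fun b' => (t : ℂ) • D b')) b : Matrix.specialUnitaryGroup (Fin 2) ℂ) : Matrix (Fin 2) (Fin 2) ℂ)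
        * star (W b : Matrix (Fin 2) (Fin 2) ℂ)
      = exp (Complex.I • ((t : ℂ) • D b)) := by
  have hW : (W b : Matrix (Fin 2) (Fin 2) ℂ) * star (W b : Matrix (Fin 2) (Fin 2) ℂ) = 1 := Matrix.mem_unitaryGroup_iff.mp (W b).2.1
  have hcoe : ((emb15 W (expHermField (fun b' => (t : ℂ) • D b')) b : Matrix.specialUnitaryGroup (Fin 2) ℂ) : Matrix (Fin 2) (Fin 2) ℂ)
      = exp (Complex.I • ((t : ℂ) • D b)) * (W b : Matrix (Fin 2) (Fin 2) ℂ) := by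
    show (((expHerm ((t : ℂ) • D b)) * W b : Matrix.specialUnitaryGroup (Fin 2) ℂ) : Matrix (Fin 2) (Fin 2) ℂ) = _
    rw [Submonoid.coe_mul, coe_expHerm (herm_tr_ofReal_smul (hD b) t)]
  rw [hcoe, mul_assoc, hW, mul_one]

/-- **THE RAY'S BOND VELOCITY IS `iD(b)`**: `t ↦ (e^{itD}W)(b)·W(b)^*` has derivative `i·D(b)` at `t = 0` (`D exp(0) = id`, restricted to real `t`).
[cite: Balaban1985Variational, (112) p.294, (44)-(45) p.285] -/
theorem hasDerivAt_expHermRay (W : GaugeField (F.P K) 0 (Matrix.specialUnitaryGroup (Fin 2) ℂ)) (D : PBond (F.P K) 0 → Matrix (Fin 2) (Fin 2) ℂ)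
    (hD : ∀ b : PBond (F.P K) 0, (D b).IsHermitian ∧ Matrix.trace (D b) = 0) (b : PBond (F.P K) 0) :
    HasDerivAt (fun t : ℝ => ((emb15 W (expHermField (fun b' => (t : ℂ) • D b')) b : Matrix.specialUnitaryGroup (Fin 2) ℂ) : Matrix (Fin 2) (Fin 2) ℂ)
        * star (W b : Matrix (Fin 2) (Fin 2) ℂ)) (Complex.I • D b) 0 := by
  have hfun : (fun t : ℝ => ((emb15 W (expHermField (fun b' => (t : ℂ) • D b')) b : Matrix.specialUnitaryGroup (Fin 2) ℂ) : Matrix (Fin 2) (Fin 2) ℂ)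
        * star (W b : Matrix (Fin 2) (Fin 2) ℂ))
      = (NormedSpace.exp : Matrix (Fin 2) (Fin 2) ℂ → Matrix (Fin 2) (Fin 2) ℂ) ∘ (fun t : ℝ => (t : ℂ) • (Complex.I • D b)) := by
    funext t
    rw [coe_expHermRay_mul_star W D hD t b, Function.comp_apply, smul_comm]
  rw [hfun]
  have hexp : HasFDerivAt (NormedSpace.exp : Matrix (Fin 2) (Fin 2) ℂ → Matrix (Fin 2) (Fin 2) ℂ)
      ((1 : Matrix (Fin 2) (Fin 2) ℂ →L[ℂ] Matrix (Fin 2) (Fin 2) ℂ).restrictScalars ℝ) 0 :=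
    ((hasStrictFDerivAt_exp_zero (𝕂 := ℂ) (𝔸 := Matrix (Fin 2) (Fin 2) ℂ)).hasFDerivAt).restrictScalars ℝ
  have hlin : HasDerivAt (fun t : ℝ => (t : ℂ) • (Complex.I • D b)) (Complex.I • D b) 0 := by
    have h := (Complex.ofRealCLM.hasDerivAt (x := (0 : ℝ))).smul_const (Complex.I • D b)
    simpa using h
  have h00 : (0 : Matrix (Fin 2) (Fin 2) ℂ) = (fun t : ℝ => (t : ℂ) • (Complex.I • D b)) 0 := by simp
  have hcomp := hexp.comp_hasDerivAt_of_eq (0 : ℝ) hlin h00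
  simpa using hcomp

/-- The ray is continuous at `t = 0` (bondwise differentiable there). [folklore] -/
theorem continuousAt_expHermRay (W : GaugeField (F.P K) 0 (Matrix.specialUnitaryGroup (Fin 2) ℂ)) (D : PBond (F.P K) 0 → Matrix (Fin 2) (Fin 2) ℂ)
    (hD : ∀ b : PBond (F.P K) 0, (D b).IsHermitian ∧ Matrix.trace (D b) = 0) :
    ContinuousAt (fun t : ℝ => emb15 W (expHermField (fun b' => (t : ℂ) • D b'))) 0 := by
  refine continuousAt_of_differentiableAt_bonds _ fun b => ?_
  have hW1 : star (W b : Matrix (Fin 2) (Fin 2) ℂ) * (W b : Matrix (Fin 2) (Fin 2) ℂ) = 1 := Matrix.mem_unitaryGroup_iff'.mp (W b).2.1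
  have hfun : (fun t : ℝ => ((emb15 W (expHermField (fun b' => (t : ℂ) • D b')) b : Matrix.specialUnitaryGroup (Fin 2) ℂ) : Matrix (Fin 2) (Fin 2) ℂ))
      = fun t : ℝ => (((emb15 W (expHermField (fun b' => (t : ℂ) • D b')) b : Matrix.specialUnitaryGroup (Fin 2) ℂ) : Matrix (Fin 2) (Fin 2) ℂ)
          * star (W b : Matrix (Fin 2) (Fin 2) ℂ)) * (W b : Matrix (Fin 2) (Fin 2) ℂ) := by
    funext t; rw [mul_assoc, hW1, mul_one]
  rw [hfun]
  exact ((hasDerivAt_expHermRay W D hD b).mul_const _).differentiableAt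

/-- The ray starts at `W`: `e^{i·0·D}W = W`. [cite: Balaban1985Variational, (112) p.294] -/
theorem expHermRay_zero (W : GaugeField (F.P K) 0 (Matrix.specialUnitaryGroup (Fin 2) ℂ)) (D : PBond (F.P K) 0 → Matrix (Fin 2) (Fin 2) ℂ) :
    emb15 W (expHermField (fun b' => ((0 : ℝ) : ℂ) • D b')) = W := by
  funext b
  have h0 : (fun b' : PBond (F.P K) 0 => ((0 : ℝ) : ℂ) • D b') = fun _ => 0 := by
    funext b'; rw [Complex.ofReal_zero, zero_smul]
  rw [h0, Prop7TPrint.expHermField_zero]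
  show (1 : Matrix.specialUnitaryGroup (Fin 2) ℂ) * W b = W b
  exact one_mul (W b)

end Ray

/-! ## §3 The `hEL` row of the chart-currency knit: exact on Σ_k-rays, Lipschitz-small off the tangent space of Σ_k -/

section EL

variable {F : T3Family} {n K : ℕ} {h : n ≤ K}

/-- ★★ **`EL_W` EXACT (λ = 0)**: at an R2-critical `W`, for a Hermitian-traceless direction `D` whose exponential ray `e^{itD}W` has gauge copies in `𝔅_k(V)` for `t` near
`0` (a Σ_k-ray), the first differential of the action through the chart vanishes: `ℓ_W(D) = 0` — the `hEL` letter of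
`Prop7Growth142T3ChartKnit.cmin_minimality_of_chartRows` with `λ = 0`. [cite: Balaban1985Variational, (141) p.299, (112) p.294] -/
theorem lin_chart_eq_zero_of_isCritR2_of_raySigma {V : GaugeField (F.P n) 0 (Matrix.specialUnitaryGroup (Fin 2) ℂ)} {W : GaugeField (F.P K) 0 (Matrix.specialUnitaryGroup (Fin 2) ℂ)}
    (hW : IsCritR2 F n K h V W) (D : PBond (F.P K) 0 → Matrix (Fin 2) (Fin 2) ℂ) (hD : ∀ b : PBond (F.P K) 0, (D b).IsHermitian ∧ Matrix.trace (D b) = 0)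
    (hray : ∀ᶠ t : ℝ in 𝓝 (0 : ℝ), ∃ u : GaugeTransf (F.P K) 0 (Matrix.specialUnitaryGroup (Fin 2) ℂ),
      GaugeField.gaugeAct u (emb15 W (expHermField (fun b => (t : ℂ) • D b))) ∈ fibre F ℰp n K h V) :
    ∑ p : Plaq (F.P K) 0, (1 / 2) * (((((GaugeField.plaqHol W p : Matrix.specialUnitaryGroup (Fin 2) ℂ) : Matrix (Fin 2) (Fin 2) ℂ) - 1)ᴴ * (((Complex.I • D ⟨p.src, p.μ⟩) + ((W ⟨p.src, p.μ⟩ : Matrix (Fin 2) (Fin 2) ℂ) * (Complex.I • D ⟨p.src.shift p.μ, p.ν⟩) * star (W ⟨p.src, p.μ⟩ : Matrix (Fin 2) (Fin 2) ℂ))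
            - (((W ⟨p.src, p.μ⟩ * W ⟨p.src.shift p.μ, p.ν⟩ * (W ⟨p.src.shift p.ν, p.μ⟩)⁻¹ : Matrix.specialUnitaryGroup (Fin 2) ℂ) : Matrix (Fin 2) (Fin 2) ℂ) * (Complex.I • D ⟨p.src.shift p.ν, p.μ⟩) * star ((W ⟨p.src, p.μ⟩ * W ⟨p.src.shift p.μ, p.ν⟩ * (W ⟨p.src.shift p.ν, p.μ⟩)⁻¹ : Matrix.specialUnitaryGroup (Fin 2) ℂ) : Matrix (Fin 2) (Fin 2) ℂ))
            - (((GaugeField.plaqHol W p : Matrix.specialUnitaryGroup (Fin 2) ℂ) : Matrix (Fin 2) (Fin 2) ℂ) * (Complex.I • D ⟨p.src, p.ν⟩) * star ((GaugeField.plaqHol W p : Matrix.specialUnitaryGroup (Fin 2) ℂ) : Matrix (Fin 2) (Fin 2) ℂ))) * ((GaugeField.plaqHol W p : Matrix.specialUnitaryGroup (Fin 2) ℂ) : Matrix (Fin 2) (Fin 2) ℂ))).trace).re = 0 :=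
  lin_eq_zero_of_isCritR2_of_gaugeFibre hW (fun t : ℝ => emb15 W (expHermField (fun b => (t : ℂ) • D b))) (expHermRay_zero W D)
    (continuousAt_expHermRay W D hD) hray (fun b => Complex.I • D b) (fun b => hasDerivAt_expHermRay W D hD b)

end EL

section Lipschitz

variable {P : Params} {j : ℕ}

/-- ★ **`Lin_W` IS LIPSCHITZ WITH THE SMALL CONSTANT `4d·a`** at a background whose plaquette variables lie within `a` of `1`:
`|Lin_W(ξ) − Lin_W(ξ′)| ≤ a·4d·Σ_b‖ξ(b) − ξ′(b)‖` (per plaquette `‖W(∂p) − 1‖·Σ_{b∈∂p}‖ξ(b) − ξ′(b)‖`, T3W §7 `norm_lin_sub_lin_le`; incidence `4d`).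
[cite: Balaban1985Variational, (127) p.297, (26)-(28) p.282] -/
theorem abs_lin_sub_lin_le_of_plaqNear (W : GaugeField P j (Matrix.specialUnitaryGroup (Fin 2) ℂ)) {a : ℝ} (ha0 : 0 ≤ a)
    (ha : ∀ p : Plaq P j, ‖((GaugeField.plaqHol W p : Matrix.specialUnitaryGroup (Fin 2) ℂ) : Matrix (Fin 2) (Fin 2) ℂ) - 1‖ ≤ a)
    (ξ ξ' : PBond P j → Matrix (Fin 2) (Fin 2) ℂ) :
    |(∑ p : Plaq P j, (1 / 2) * ((((((GaugeField.plaqHol W p : Matrix.specialUnitaryGroup (Fin 2) ℂ) : Matrix (Fin 2) (Fin 2) ℂ)) - 1)ᴴ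
          * ((ξ ⟨p.src, p.μ⟩
              + (W ⟨p.src, p.μ⟩ : Matrix (Fin 2) (Fin 2) ℂ) * ξ ⟨p.src.shift p.μ, p.ν⟩ * star (W ⟨p.src, p.μ⟩ : Matrix (Fin 2) (Fin 2) ℂ)
              - ((W ⟨p.src, p.μ⟩ * W ⟨p.src.shift p.μ, p.ν⟩ * (W ⟨p.src.shift p.ν, p.μ⟩)⁻¹ : Matrix.specialUnitaryGroup (Fin 2) ℂ) : Matrix (Fin 2) (Fin 2) ℂ)
                  * ξ ⟨p.src.shift p.ν, p.μ⟩
                  * star ((W ⟨p.src, p.μ⟩ * W ⟨p.src.shift p.μ, p.ν⟩ * (W ⟨p.src.shift p.ν, p.μ⟩)⁻¹ : Matrix.specialUnitaryGroup (Fin 2) ℂ) : Matrix (Fin 2) (Fin 2) ℂ)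
              - ((GaugeField.plaqHol W p : Matrix.specialUnitaryGroup (Fin 2) ℂ) : Matrix (Fin 2) (Fin 2) ℂ) * ξ ⟨p.src, p.ν⟩
                  * star ((GaugeField.plaqHol W p : Matrix.specialUnitaryGroup (Fin 2) ℂ) : Matrix (Fin 2) (Fin 2) ℂ))
            * ((GaugeField.plaqHol W p : Matrix.specialUnitaryGroup (Fin 2) ℂ) : Matrix (Fin 2) (Fin 2) ℂ))).trace).re)
      - (∑ p : Plaq P j, (1 / 2) * ((((((GaugeField.plaqHol W p : Matrix.specialUnitaryGroup (Fin 2) ℂ) : Matrix (Fin 2) (Fin 2) ℂ)) - 1)ᴴ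
          * ((ξ' ⟨p.src, p.μ⟩
              + (W ⟨p.src, p.μ⟩ : Matrix (Fin 2) (Fin 2) ℂ) * ξ' ⟨p.src.shift p.μ, p.ν⟩ * star (W ⟨p.src, p.μ⟩ : Matrix (Fin 2) (Fin 2) ℂ)
              - ((W ⟨p.src, p.μ⟩ * W ⟨p.src.shift p.μ, p.ν⟩ * (W ⟨p.src.shift p.ν, p.μ⟩)⁻¹ : Matrix.specialUnitaryGroup (Fin 2) ℂ) : Matrix (Fin 2) (Fin 2) ℂ)
                  * ξ' ⟨p.src.shift p.ν, p.μ⟩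
                  * star ((W ⟨p.src, p.μ⟩ * W ⟨p.src.shift p.μ, p.ν⟩ * (W ⟨p.src.shift p.ν, p.μ⟩)⁻¹ : Matrix.specialUnitaryGroup (Fin 2) ℂ) : Matrix (Fin 2) (Fin 2) ℂ)
              - ((GaugeField.plaqHol W p : Matrix.specialUnitaryGroup (Fin 2) ℂ) : Matrix (Fin 2) (Fin 2) ℂ) * ξ' ⟨p.src, p.ν⟩
                  * star ((GaugeField.plaqHol W p : Matrix.specialUnitaryGroup (Fin 2) ℂ) : Matrix (Fin 2) (Fin 2) ℂ))
            * ((GaugeField.plaqHol W p : Matrix.specialUnitaryGroup (Fin 2) ℂ) : Matrix (Fin 2) (Fin 2) ℂ))).trace).re)|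
      ≤ a * (4 * (P.d : ℝ) * ∑ b : PBond P j, ‖ξ b - ξ' b‖) := by
  rw [← Finset.sum_sub_distrib]
  refine (Finset.abs_sum_le_sum_abs _ _).trans ?_
  have hper : ∀ p : Plaq P j,
      |(1 / 2) * ((((((GaugeField.plaqHol W p : Matrix.specialUnitaryGroup (Fin 2) ℂ) : Matrix (Fin 2) (Fin 2) ℂ)) - 1)ᴴ
          * ((ξ ⟨p.src, p.μ⟩
              + (W ⟨p.src, p.μ⟩ : Matrix (Fin 2) (Fin 2) ℂ) * ξ ⟨p.src.shift p.μ, p.ν⟩ * star (W ⟨p.src, p.μ⟩ : Matrix (Fin 2) (Fin 2) ℂ)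
              - ((W ⟨p.src, p.μ⟩ * W ⟨p.src.shift p.μ, p.ν⟩ * (W ⟨p.src.shift p.ν, p.μ⟩)⁻¹ : Matrix.specialUnitaryGroup (Fin 2) ℂ) : Matrix (Fin 2) (Fin 2) ℂ)
                  * ξ ⟨p.src.shift p.ν, p.μ⟩
                  * star ((W ⟨p.src, p.μ⟩ * W ⟨p.src.shift p.μ, p.ν⟩ * (W ⟨p.src.shift p.ν, p.μ⟩)⁻¹ : Matrix.specialUnitaryGroup (Fin 2) ℂ) : Matrix (Fin 2) (Fin 2) ℂ)
              - ((GaugeField.plaqHol W p : Matrix.specialUnitaryGroup (Fin 2) ℂ) : Matrix (Fin 2) (Fin 2) ℂ) * ξ ⟨p.src, p.ν⟩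
                  * star ((GaugeField.plaqHol W p : Matrix.specialUnitaryGroup (Fin 2) ℂ) : Matrix (Fin 2) (Fin 2) ℂ))
            * ((GaugeField.plaqHol W p : Matrix.specialUnitaryGroup (Fin 2) ℂ) : Matrix (Fin 2) (Fin 2) ℂ))).trace).re
        - (1 / 2) * ((((((GaugeField.plaqHol W p : Matrix.specialUnitaryGroup (Fin 2) ℂ) : Matrix (Fin 2) (Fin 2) ℂ)) - 1)ᴴ
          * ((ξ' ⟨p.src, p.μ⟩
              + (W ⟨p.src, p.μ⟩ : Matrix (Fin 2) (Fin 2) ℂ) * ξ' ⟨p.src.shift p.μ, p.ν⟩ * star (W ⟨p.src, p.μ⟩ : Matrix (Fin 2) (Fin 2) ℂ)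
              - ((W ⟨p.src, p.μ⟩ * W ⟨p.src.shift p.μ, p.ν⟩ * (W ⟨p.src.shift p.ν, p.μ⟩)⁻¹ : Matrix.specialUnitaryGroup (Fin 2) ℂ) : Matrix (Fin 2) (Fin 2) ℂ)
                  * ξ' ⟨p.src.shift p.ν, p.μ⟩
                  * star ((W ⟨p.src, p.μ⟩ * W ⟨p.src.shift p.μ, p.ν⟩ * (W ⟨p.src.shift p.ν, p.μ⟩)⁻¹ : Matrix.specialUnitaryGroup (Fin 2) ℂ) : Matrix (Fin 2) (Fin 2) ℂ)
              - ((GaugeField.plaqHol W p : Matrix.specialUnitaryGroup (Fin 2) ℂ) : Matrix (Fin 2) (Fin 2) ℂ) * ξ' ⟨p.src, p.ν⟩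
                  * star ((GaugeField.plaqHol W p : Matrix.specialUnitaryGroup (Fin 2) ℂ) : Matrix (Fin 2) (Fin 2) ℂ))
            * ((GaugeField.plaqHol W p : Matrix.specialUnitaryGroup (Fin 2) ℂ) : Matrix (Fin 2) (Fin 2) ℂ))).trace).re|
        ≤ a * (‖ξ ⟨p.src, p.μ⟩ - ξ' ⟨p.src, p.μ⟩‖ + ‖ξ ⟨p.src.shift p.μ, p.ν⟩ - ξ' ⟨p.src.shift p.μ, p.ν⟩‖
              + ‖ξ ⟨p.src.shift p.ν, p.μ⟩ - ξ' ⟨p.src.shift p.ν, p.μ⟩‖ + ‖ξ ⟨p.src, p.ν⟩ - ξ' ⟨p.src, p.ν⟩‖) := by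
    intro p
    have h2 := norm_lin_sub_lin_le (W ⟨p.src, p.μ⟩) (W ⟨p.src, p.μ⟩ * W ⟨p.src.shift p.μ, p.ν⟩ * (W ⟨p.src.shift p.ν, p.μ⟩)⁻¹) (GaugeField.plaqHol W p)
      (ξ ⟨p.src, p.μ⟩) (ξ ⟨p.src.shift p.μ, p.ν⟩) (ξ ⟨p.src.shift p.ν, p.μ⟩) (ξ ⟨p.src, p.ν⟩)
      (ξ' ⟨p.src, p.μ⟩) (ξ' ⟨p.src.shift p.μ, p.ν⟩) (ξ' ⟨p.src.shift p.ν, p.μ⟩) (ξ' ⟨p.src, p.ν⟩)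
    have h1 := abs_half_re_trace_sub_le ((GaugeField.plaqHol W p : Matrix.specialUnitaryGroup (Fin 2) ℂ) : Matrix (Fin 2) (Fin 2) ℂ)
      (ξ ⟨p.src, p.μ⟩
              + (W ⟨p.src, p.μ⟩ : Matrix (Fin 2) (Fin 2) ℂ) * ξ ⟨p.src.shift p.μ, p.ν⟩ * star (W ⟨p.src, p.μ⟩ : Matrix (Fin 2) (Fin 2) ℂ)
              - ((W ⟨p.src, p.μ⟩ * W ⟨p.src.shift p.μ, p.ν⟩ * (W ⟨p.src.shift p.ν, p.μ⟩)⁻¹ : Matrix.specialUnitaryGroup (Fin 2) ℂ) : Matrix (Fin 2) (Fin 2) ℂ)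
                  * ξ ⟨p.src.shift p.ν, p.μ⟩
                  * star ((W ⟨p.src, p.μ⟩ * W ⟨p.src.shift p.μ, p.ν⟩ * (W ⟨p.src.shift p.ν, p.μ⟩)⁻¹ : Matrix.specialUnitaryGroup (Fin 2) ℂ) : Matrix (Fin 2) (Fin 2) ℂ)
              - ((GaugeField.plaqHol W p : Matrix.specialUnitaryGroup (Fin 2) ℂ) : Matrix (Fin 2) (Fin 2) ℂ) * ξ ⟨p.src, p.ν⟩
                  * star ((GaugeField.plaqHol W p : Matrix.specialUnitaryGroup (Fin 2) ℂ) : Matrix (Fin 2) (Fin 2) ℂ))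
      (ξ' ⟨p.src, p.μ⟩
              + (W ⟨p.src, p.μ⟩ : Matrix (Fin 2) (Fin 2) ℂ) * ξ' ⟨p.src.shift p.μ, p.ν⟩ * star (W ⟨p.src, p.μ⟩ : Matrix (Fin 2) (Fin 2) ℂ)
              - ((W ⟨p.src, p.μ⟩ * W ⟨p.src.shift p.μ, p.ν⟩ * (W ⟨p.src.shift p.ν, p.μ⟩)⁻¹ : Matrix.specialUnitaryGroup (Fin 2) ℂ) : Matrix (Fin 2) (Fin 2) ℂ)
                  * ξ' ⟨p.src.shift p.ν, p.μ⟩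
                  * star ((W ⟨p.src, p.μ⟩ * W ⟨p.src.shift p.μ, p.ν⟩ * (W ⟨p.src.shift p.ν, p.μ⟩)⁻¹ : Matrix.specialUnitaryGroup (Fin 2) ℂ) : Matrix (Fin 2) (Fin 2) ℂ)
              - ((GaugeField.plaqHol W p : Matrix.specialUnitaryGroup (Fin 2) ℂ) : Matrix (Fin 2) (Fin 2) ℂ) * ξ' ⟨p.src, p.ν⟩
                  * star ((GaugeField.plaqHol W p : Matrix.specialUnitaryGroup (Fin 2) ℂ) : Matrix (Fin 2) (Fin 2) ℂ))
      (GaugeField.plaqHol W p).2.1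
    exact h1.trans (mul_le_mul (ha p) h2 (norm_nonneg _) ha0)
  calc ∑ p : Plaq P j, _ ≤ ∑ p : Plaq P j, a * (‖ξ ⟨p.src, p.μ⟩ - ξ' ⟨p.src, p.μ⟩‖ + ‖ξ ⟨p.src.shift p.μ, p.ν⟩ - ξ' ⟨p.src.shift p.μ, p.ν⟩‖
              + ‖ξ ⟨p.src.shift p.ν, p.μ⟩ - ξ' ⟨p.src.shift p.ν, p.μ⟩‖ + ‖ξ ⟨p.src, p.ν⟩ - ξ' ⟨p.src, p.ν⟩‖) :=
        Finset.sum_le_sum fun p _ => hper p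
    _ = a * ∑ p : Plaq P j, (‖ξ ⟨p.src, p.μ⟩ - ξ' ⟨p.src, p.μ⟩‖ + ‖ξ ⟨p.src.shift p.μ, p.ν⟩ - ξ' ⟨p.src.shift p.μ, p.ν⟩‖
              + ‖ξ ⟨p.src.shift p.ν, p.μ⟩ - ξ' ⟨p.src.shift p.ν, p.μ⟩‖ + ‖ξ ⟨p.src, p.ν⟩ - ξ' ⟨p.src, p.ν⟩‖) := by rw [Finset.mul_sum]
    _ ≤ a * (4 * (P.d : ℝ) * ∑ b : PBond P j, ‖ξ b - ξ' b‖) :=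
        mul_le_mul_of_nonneg_left (sum_plaq_bonds_le (P := P) (j := j) (fun b => ‖ξ b - ξ' b‖) fun b => norm_nonneg _) ha0

end Lipschitz

section ApproxEL

variable {F : T3Family} {n K : ℕ} {h : n ≤ K}

/-- `regThreshold e = e·L^{−2(K−n)} ≤ e` for `e ≥ 0`. [cite: Balaban1985Variational, (2) p.278] -/
theorem regThreshold_le_self {e : ℝ} (he : 0 ≤ e) : regThreshold F n K e ≤ e := by
  unfold regThreshold
  have hL : (1 : ℝ) ≤ (F.L : ℝ) := by have := F.hL.2; exact_mod_cast (by omega : 1 ≤ F.L)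
  have h1 : ((F.L : ℝ)⁻¹) ^ (2 * (K - n)) ≤ 1 := pow_le_one₀ (inv_nonneg.mpr (by linarith)) (inv_le_one_of_one_le₀ hL)
  calc e * ((F.L : ℝ)⁻¹) ^ (2 * (K - n)) ≤ e * 1 := mul_le_mul_of_nonneg_left h1 he
    _ = e := mul_one e

/-- ★★ **`EL_W` FOR A GENERAL CHART COMPETITOR, DRIFT-FREE**: at an R2-critical `W ∈ (6)(e) ∩ 𝔅_k(V)`, for a Hermitian-traceless `D` and ANY Σ_k-curve `γ` through
`W` (continuous at `0`, gauge copies in `𝔅_k(V)` near `0`, bond velocities `ξ`): `|ℓ_W(D)| ≤ e·L^{−2(K−n)}·4d·Σ_b‖iD(b) − ξ(b)‖` — the first variation of the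
competitor is controlled by the distance of its coordinate to the tangent space of Σ_k ALONE (`Lin_W(ξ) = 0` by §1, Lipschitz by §3); with print's
straightening `D − ξ = −H·`(quadratic defect) this is the `λ·Σ‖D‖²` of the knit's `hEL`. [cite: Balaban1985Variational, (141) p.299, (47)-(48) pp.285-286] -/
theorem abs_lin_chart_le_of_sigmaVelocity {V : GaugeField (F.P n) 0 (Matrix.specialUnitaryGroup (Fin 2) ℂ)} {W : GaugeField (F.P K) 0 (Matrix.specialUnitaryGroup (Fin 2) ℂ)}
    (hW : IsCritR2 F n K h V W) {e : ℝ} (hWe : W ∈ regFibrePr F n K h e V)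
    (D : PBond (F.P K) 0 → Matrix (Fin 2) (Fin 2) ℂ)
    (γ : ℝ → GaugeField (F.P K) 0 (Matrix.specialUnitaryGroup (Fin 2) ℂ)) (hγ0 : γ 0 = W) (hγc : ContinuousAt γ 0)
    (hγfib : ∀ᶠ t in 𝓝 (0 : ℝ), ∃ u : GaugeTransf (F.P K) 0 (Matrix.specialUnitaryGroup (Fin 2) ℂ), GaugeField.gaugeAct u (γ t) ∈ fibre F ℰp n K h V)
    (ξ : PBond (F.P K) 0 → Matrix (Fin 2) (Fin 2) ℂ)
    (hγξ : ∀ b : PBond (F.P K) 0, HasDerivAt (fun t : ℝ => (γ t b : Matrix (Fin 2) (Fin 2) ℂ) * star (W b : Matrix (Fin 2) (Fin 2) ℂ)) (ξ b) 0) :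
    |∑ p : Plaq (F.P K) 0, (1 / 2) * (((((GaugeField.plaqHol W p : Matrix.specialUnitaryGroup (Fin 2) ℂ) : Matrix (Fin 2) (Fin 2) ℂ) - 1)ᴴ * (((Complex.I • D ⟨p.src, p.μ⟩) + ((W ⟨p.src, p.μ⟩ : Matrix (Fin 2) (Fin 2) ℂ) * (Complex.I • D ⟨p.src.shift p.μ, p.ν⟩) * star (W ⟨p.src, p.μ⟩ : Matrix (Fin 2) (Fin 2) ℂ))
            - (((W ⟨p.src, p.μ⟩ * W ⟨p.src.shift p.μ, p.ν⟩ * (W ⟨p.src.shift p.ν, p.μ⟩)⁻¹ : Matrix.specialUnitaryGroup (Fin 2) ℂ) : Matrix (Fin 2) (Fin 2) ℂ) * (Complex.I • D ⟨p.src.shift p.ν, p.μ⟩) * star ((W ⟨p.src, p.μ⟩ * W ⟨p.src.shift p.μ, p.ν⟩ * (W ⟨p.src.shift p.ν, p.μ⟩)⁻¹ : Matrix.specialUnitaryGroup (Fin 2) ℂ) : Matrix (Fin 2) (Fin 2) ℂ))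
            - (((GaugeField.plaqHol W p : Matrix.specialUnitaryGroup (Fin 2) ℂ) : Matrix (Fin 2) (Fin 2) ℂ) * (Complex.I • D ⟨p.src, p.ν⟩) * star ((GaugeField.plaqHol W p : Matrix.specialUnitaryGroup (Fin 2) ℂ) : Matrix (Fin 2) (Fin 2) ℂ))) * ((GaugeField.plaqHol W p : Matrix.specialUnitaryGroup (Fin 2) ℂ) : Matrix (Fin 2) (Fin 2) ℂ))).trace).re|
      ≤ regThreshold F n K e * (4 * ((F.P K).d : ℝ) * ∑ b : PBond (F.P K) 0, ‖Complex.I • D b - ξ b‖) := by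
  have h0 := lin_eq_zero_of_isCritR2_of_gaugeFibre hW γ hγ0 hγc hγfib ξ hγξ
  have hreg : RegPr F n K e W := ((mem_regFibrePr_iff F).mp hWe).2
  have he0 : 0 < e := pos_of_regPr F hreg
  have hthr0 : 0 ≤ regThreshold F n K e := by unfold regThreshold; positivity
  have ha : ∀ p : Plaq (F.P K) 0, ‖((GaugeField.plaqHol W p : Matrix.specialUnitaryGroup (Fin 2) ℂ) : Matrix (Fin 2) (Fin 2) ℂ) - 1‖ ≤ regThreshold F n K e := fun p => by
    have hp := hreg.1 p
    rw [SU2Mean.dist1_eq_norm] at hp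
    exact hp.le
  have h := abs_lin_sub_lin_le_of_plaqNear W hthr0 ha (fun b => Complex.I • D b) ξ
  simpa only [h0, sub_zero] using h

end ApproxEL

end Summit.QuantumFields.YangMills.Theorems.Prop7Growth142T3ChartEL

end
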